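import Literature.NumberTheory.LFunctions.WeilMellinInversion
import Mathlib.Analysis.Distribution.SchwartzSpace.Deriv
import Mathlib.Analysis.Fourier.FourierTransform
import Mathlib.Analysis.Convolution
import HarnessLib

/-!
# Band exclusion: the feedback is invisible to the window (`stub_bandExclusion`)

Route `SpectralTrace`, crux `WindowStep` (stmt-RiemannHypothesis-14659), line `floor-feedback`, stub
`stub_bandExclusion` (K2a).

**Statement.** Let `g` be a Weil test function with `tsupport g ⊆ [-A, A]`, `k` a real Schwartz function
whose Fourier transform (Mathlib's normalisation `𝓕 f(w) = ∫ e^{-2πi vw} f(v) dv`) is `≡ 1` on the band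
`|w| ≤ A/(2π)`, and `b` a bounded measurable real function. With `F(T) = ĝ(1/2 + iT) = ∫ g(t) e^{iTt} dt`
(`weilMellin` on the critical line),
`∫ F(T) (k ⋆ b)(T) dT = ∫ F(T) b(T) dT`, where `(k ⋆ b)(T) = ∫ k(T - s) b(s) ds`.

**Proof.** `F` is integrable (`integrable_weilMellin_vertical`), `k` is integrable and `b` is bounded, so
`(T, s) ↦ F(T) k(T - s) b(s)` is integrable on `ℝ²` (`Integrable.convolution_integrand`) and Fubini gives
`∫ F · (k ⋆ b) = ∫ b(s) (∫ F(T) k(T - s) dT) ds`. The inner integral is `F(s)`: expanding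
`F(T) = ∫ g(t) e^{iTt} dt` and swapping the integrals once more (`g` is continuous of compact support),
`∫ F(T) k(T - s) dT = ∫ g(t) e^{ist} (∫ k(u) e^{iut} du) dt = ∫ g(t) e^{ist} 𝓕k(-t/(2π)) dt = ∫ g(t) e^{ist} dt`,
because `|t| ≤ A` wherever `g(t) ≠ 0`. No Fourier inversion is used. [folklore]
-/

set_option linter.dupNamespace false

noncomputable section

open Complex Filter Set MeasureTheory
open scoped Real Topology BigOperators FourierTransform SchwartzMap

namespace Summit.RiemannHypothesis.RiemannHypothesis.Theorems.SpectralTraceWindowStep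

open Literature.NumberTheory.LFunctions

/-- On the critical line the Weil transform is `ĝ(1/2 + iT) = ∫ g(t) e^{iTt} dt`. [folklore] -/
theorem stub_bandExclusion_line (g : ℝ → ℂ) (T : ℝ) :
    weilMellin g (1 / 2 + (T : ℂ) * I) = ∫ t : ℝ, g t * cexp ((T : ℂ) * I * t) := by
  unfold weilMellin
  congr 1 with t
  congr 2
  ring

/-- `∫ e^{iut} k(u) du = 𝓕k(-t/(2π))` in Mathlib's normalisation `𝓕 f(w) = ∫ e^{-2πi vw} f(v) dv`.
[folklore] -/
theorem stub_bandExclusion_fourier (k : 𝓢(ℝ, ℝ)) (t : ℝ) :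
    ∫ u : ℝ, cexp ((u : ℂ) * I * t) * ((k u : ℝ) : ℂ) =
      𝓕 (fun T : ℝ => ((k T : ℝ) : ℂ)) (-t / (2 * π)) := by
  rw [Real.fourier_real_eq_integral_exp_smul]
  congr 1 with u
  rw [smul_eq_mul]
  congr 2
  have h : -2 * π * u * (-t / (2 * π)) = u * t := by
    field_simp
  rw [h]
  push_cast
  ring

/-- Translating the kernel: `∫ e^{iTt} k(T - s) dT = e^{ist} 𝓕k(-t/(2π))`. [folklore] -/
theorem stub_bandExclusion_shift (k : 𝓢(ℝ, ℝ)) (s t : ℝ) :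
    ∫ T : ℝ, cexp ((T : ℂ) * I * t) * ((k (T - s) : ℝ) : ℂ) =
      cexp ((s : ℂ) * I * t) * 𝓕 (fun T : ℝ => ((k T : ℝ) : ℂ)) (-t / (2 * π)) := by
  rw [← stub_bandExclusion_fourier, ← integral_const_mul,
    ← integral_add_right_eq_self (μ := volume)
      (fun T : ℝ => cexp ((T : ℂ) * I * t) * ((k (T - s) : ℝ) : ℂ)) s]
  congr 1 with u
  rw [add_sub_cancel_right, ← mul_assoc, ← Complex.exp_add]
  congr 2
  push_cast
  ring

/-- The integrand `(T, t) ↦ g(t) e^{iTt} k(T - s)` of the double integral defining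
`∫ ĝ(1/2 + iT) k(T - s) dT` is integrable on `ℝ²` (dominated by `|k(T - s)| ‖g(t)‖`). [folklore] -/
theorem stub_bandExclusion_integrable {g : ℝ → ℂ} (hg : IsWeilTest g) (k : 𝓢(ℝ, ℝ)) (s : ℝ) :
    Integrable (Function.uncurry fun (T : ℝ) (t : ℝ) =>
      g t * (cexp ((T : ℂ) * I * t) * ((k (T - s) : ℝ) : ℂ))) (volume.prod volume) := by
  have hgc : Continuous g := hg.1.continuous
  have hgi : Integrable g := hgc.integrable_of_hasCompactSupport hg.2
  have hki : Integrable (fun T : ℝ => ((k (T - s) : ℝ) : ℂ)) :=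
    ((SchwartzMap.integrable k).comp_sub_right s).ofReal
  refine (hki.mul_prod hgi).mono ?_ (Eventually.of_forall fun p => ?_)
  · exact (by fun_prop : Continuous (Function.uncurry fun (T : ℝ) (t : ℝ) =>
      g t * (cexp ((T : ℂ) * I * t) * ((k (T - s) : ℝ) : ℂ)))).aestronglyMeasurable
  · obtain ⟨T, t⟩ := p
    simp only [Function.uncurry_apply_pair, norm_mul]
    rw [show (T : ℂ) * I * t = ((T * t : ℝ) : ℂ) * I by push_cast; ring,
      Complex.norm_exp_ofReal_mul_I, one_mul, mul_comm]

/-- **The key identity**: `∫ ĝ(1/2 + iT) k(T - s) dT = ĝ(1/2 + is)` for a Weil test `g` supported in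
`[-A, A]` and a real Schwartz `k` with `𝓕k ≡ 1` on `|w| ≤ A/(2π)` (Fubini, the substitution `T = u + s`,
and `∫ k(u) e^{iut} du = 𝓕k(-t/(2π)) = 1` for `|t| ≤ A`). [folklore] -/
theorem stub_bandExclusion_key {A : ℝ} {g : ℝ → ℂ} (hg : IsWeilTest g)
    (hsupp : tsupport g ⊆ Icc (-A) A) {k : 𝓢(ℝ, ℝ)}
    (hk : ∀ w : ℝ, |w| ≤ A / (2 * π) → 𝓕 (fun T : ℝ => ((k T : ℝ) : ℂ)) w = 1) (s : ℝ) :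
    ∫ T : ℝ, weilMellin g (1 / 2 + (T : ℂ) * I) * ((k (T - s) : ℝ) : ℂ) =
      weilMellin g (1 / 2 + (s : ℂ) * I) := by
  simp_rw [stub_bandExclusion_line]
  have e1 : ∀ T : ℝ, (∫ t : ℝ, g t * cexp ((T : ℂ) * I * t)) * ((k (T - s) : ℝ) : ℂ) =
      ∫ t : ℝ, g t * (cexp ((T : ℂ) * I * t) * ((k (T - s) : ℝ) : ℂ)) := fun T => by
    rw [← integral_mul_const]
    congr 1 with t
    ring
  simp_rw [e1]
  rw [integral_integral_swap (stub_bandExclusion_integrable hg k s)]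
  refine integral_congr_ae (Eventually.of_forall fun t => ?_)
  simp only
  rw [integral_const_mul, stub_bandExclusion_shift]
  by_cases hgt : g t = 0
  · simp [hgt]
  · have ht : t ∈ Icc (-A) A := hsupp (subset_tsupport _ hgt)
    have htA : |t| ≤ A := abs_le.2 ⟨ht.1, ht.2⟩
    have hw : |-t / (2 * π)| ≤ A / (2 * π) := by
      rw [abs_div, abs_neg, abs_of_pos (by positivity : (0 : ℝ) < 2 * π)]
      gcongr
    rw [hk _ hw, mul_one]

/-- The integrand `(T, s) ↦ ĝ(1/2 + iT) k(T - s) b(s)` is integrable on `ℝ²` for a Weil test `g`, a real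
Schwartz `k` and a bounded measurable `b` (`Integrable.convolution_integrand` for the integrable pair
`ĝ(1/2 + i·)`, `k(-·)`, times the bounded factor `b`). [folklore] -/
theorem stub_bandExclusion_integrable₂ {g : ℝ → ℂ} (hg : IsWeilTest g) (k : 𝓢(ℝ, ℝ)) {b : ℝ → ℝ}
    (hb : Measurable b) {B : ℝ} (hB : ∀ s : ℝ, |b s| ≤ B) :
    Integrable (Function.uncurry fun (T : ℝ) (s : ℝ) =>
      weilMellin g (1 / 2 + (T : ℂ) * I) * (((k (T - s) : ℝ) : ℂ) * ((b s : ℝ) : ℂ)))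
      (volume.prod volume) := by
  have hFi : Integrable (fun T : ℝ => weilMellin g (1 / 2 + (T : ℂ) * I)) := by
    have h := integrable_weilMellin_vertical hg (1 / 2)
    push_cast at h
    exact h
  have hki : Integrable (fun u : ℝ => ((k (-u) : ℝ) : ℂ)) :=
    (SchwartzMap.integrable k).comp_neg.ofReal
  have hconv := hFi.convolution_integrand (ContinuousLinearMap.mul ℂ ℂ) hki
    (μ := volume) (ν := volume)
  have h1 : Integrable (fun p : ℝ × ℝ =>
      weilMellin g (1 / 2 + (p.2 : ℂ) * I) * ((k (p.2 - p.1) : ℝ) : ℂ)) (volume.prod volume) := by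
    refine hconv.congr (Eventually.of_forall fun p => ?_)
    simp only [ContinuousLinearMap.mul_apply', neg_sub]
  have hbm : AEStronglyMeasurable (fun p : ℝ × ℝ => ((b p.1 : ℝ) : ℂ)) (volume.prod volume) :=
    (Complex.measurable_ofReal.comp (hb.comp measurable_fst)).aestronglyMeasurable
  have h2 := h1.mul_bdd (c := B) hbm (Eventually.of_forall fun p => by
    rw [Complex.norm_real, Real.norm_eq_abs]
    exact hB p.1)
  refine h2.swap.congr (Eventually.of_forall fun p => ?_)
  obtain ⟨T, s⟩ := p
  simp only [Function.comp_apply, Prod.swap_prod_mk, Function.uncurry_apply_pair]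
  ring

/-- **Band exclusion (`stub_bandExclusion`, K2a): the feedback is invisible to the window.** For a Weil test
`g` supported in `[-A, A]`, a real Schwartz `k` with `𝓕k ≡ 1` on `|w| ≤ A/(2π)` and a bounded measurable `b`,
`∫ ĝ(1/2 + iT) (k ⋆ b)(T) dT = ∫ ĝ(1/2 + iT) b(T) dT`: Fubini (`stub_bandExclusion_integrable₂`) and the key
identity `∫ ĝ(1/2 + iT) k(T - s) dT = ĝ(1/2 + is)` (`stub_bandExclusion_key`). [folklore] -/
theorem stub_bandExclusion : ∀ (A : ℝ) (g : ℝ → ℂ) (k : 𝓢(ℝ, ℝ)) (b : ℝ → ℝ) (B : ℝ), IsWeilTest g → tsupport g ⊆ Icc (-A) A → (∀ w : ℝ, |w| ≤ A / (2 * π) → 𝓕 (fun T : ℝ => ((k T : ℝ) : ℂ)) w = 1) → Measurable b → (∀ s : ℝ, |b s| ≤ B) → ∫ T : ℝ, weilMellin g (1 / 2 + (T : ℂ) * I) * ((∫ s : ℝ, k (T - s) * b s : ℝ) : ℂ) = ∫ T : ℝ, weilMellin g (1 / 2 + (T : ℂ) * I) * ((b T : ℝ) : ℂ) := by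
  intro A g k b B hg hsupp hk hb hB
  have h1 : ∀ T : ℝ, weilMellin g (1 / 2 + (T : ℂ) * I) * ((∫ s : ℝ, k (T - s) * b s : ℝ) : ℂ) =
      ∫ s : ℝ, weilMellin g (1 / 2 + (T : ℂ) * I) * (((k (T - s) : ℝ) : ℂ) * ((b s : ℝ) : ℂ)) := by
    intro T
    rw [← integral_complex_ofReal, ← integral_const_mul]
    congr 1 with s
    push_cast
    ring
  simp_rw [h1]
  rw [integral_integral_swap (stub_bandExclusion_integrable₂ hg k hb hB)]
  refine integral_congr_ae (Eventually.of_forall fun s => ?_)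
  simp only
  simp_rw [← mul_assoc]
  rw [integral_mul_const, stub_bandExclusion_key hg hsupp hk s]

end Summit.RiemannHypothesis.RiemannHypothesis.Theorems.SpectralTraceWindowStep

end
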